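import Literature.NumberTheory.Transcendental.KZProductIdeal
import Literature.NumberTheory.Transcendental.KZLogCalculusProofs
import Literature.NumberTheory.Transcendental.KZCalculusProofs
import Literature.NumberTheory.Transcendental.KZDominatedFamilyRelations
import Literature.NumberTheory.Transcendental.KZMellinFibres

/-!
# `NormalFormPrinciple` (stmt-KontsevichZagierPeriods-3869), line `SketchIdeator1` — stub `stub_boxCombine`

The *box-rational* family of integral representations (domain the OPEN unit box `(0,1)ᵏ`,
integrand a quotient `p/q` of polynomials over `ℚ` with `q ≠ 0` on the box, i.e. KZ's literal
§1.1 shape with the domain frozen) is closed under differences modulo the relations of the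
Kontsevich–Zagier calculus: for box-rational `N`, `N'` of any dimensions `m`, `m'` there is ONE
box-rational `M` (of dimension `m + m'`) with `[N] − [N'] − [M] ∈ relations`.

Proof (Kontsevich–Zagier 2001, §1.2, rules 1) and 3)):
* *padding by a unit interval* (`pad_one`): `[σ, f] ∼ [σ × [0,1], f ∘ init]` is one
  Newton–Leibniz move (`KZ.IntegralRep.equivalent_slab`), and the closed slab over the open box
  differs from the open box one dimension up by the null faces `{z_last = 0} ∪ {z_last = 1}`
  (rule 1a), `KZ.IntegralRep.of_sub_of_restrict_mem_relations`); the integrand stays rational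
  (`MvPolynomial.rename Fin.castSucc`);
* iterating, both representations are padded to the common dimension `m + m'` (`pad_le`);
* on the common box the integrands are subtracted by rule 1b) (`sub_same`):
  `p₁/q₁ − p₂/q₂ = (p₁q₂ − q₁p₂)/(q₁q₂)`.
-/

noncomputable section

open MeasureTheory Set
open Literature.NumberTheory.Transcendental Literature.NumberTheory.Transcendental.KZ
open Literature.ModelTheory.ExponentialFields (IsSemialgebraic)

namespace Summit.KontsevichZagierPeriods.HurwitzMicroSectors.NormalFormPrinciple.PiBox

namespace stub_boxCombineAux

variable {j K : ℕ}

/-- Membership in the open unit box one dimension up, fibrewise: `z ∈ (0,1)^{j+1}` iff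
`init z ∈ (0,1)^j` and `z_last ∈ (0,1)`. [folklore] -/
theorem mem_box_succ_iff (z : Fin (j + 1) → ℝ) :
    z ∈ {x : Fin (j + 1) → ℝ | ∀ i, x i ∈ Set.Ioo (0:ℝ) 1} ↔
      Fin.init z ∈ {x : Fin j → ℝ | ∀ i, x i ∈ Set.Ioo (0:ℝ) 1} ∧
        z (Fin.last j) ∈ Set.Ioo (0:ℝ) 1 := by
  simp only [mem_setOf_eq, Fin.forall_fin_succ', Fin.init]

/-- **Padding by one unit interval.** A box-rational representation in dimension `j` is congruent
modulo relations to a box-rational representation in dimension `j + 1`: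
`[σ, f] ∼ [σ × [0,1], f ∘ init]` (one Newton–Leibniz move, `IntegralRep.equivalent_slab`), and the
closed slab differs from the open box `(0,1)^{j+1}` by the null faces `{z_last = 0} ∪ {z_last = 1}`
(rule 1a)). [cite: KontsevichZagier2001, §1.2] -/
theorem pad_one (R : IntegralRep j) (hRd : R.domain = {x | ∀ i, x i ∈ Set.Ioo (0:ℝ) 1})
    (hRr : R.IsRational) :
    ∃ R₁ : IntegralRep (j + 1), R₁.domain = {x | ∀ i, x i ∈ Set.Ioo (0:ℝ) 1} ∧ R₁.IsRational ∧
      of R - of R₁ ∈ relations := by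
  have hsub : {x : Fin (j + 1) → ℝ | ∀ i, x i ∈ Set.Ioo (0:ℝ) 1} ⊆ (R.slab 0).domain := by
    intro z hz
    have hz' := (mem_box_succ_iff z).1 hz
    refine ⟨?_, ?_, ?_⟩
    · rw [hRd]; exact hz'.1
    · simp only [Nat.cast_zero]; exact hz'.2.1.le
    · simp only [Nat.cast_zero, zero_add]; exact hz'.2.2.le
  have hvol : volume ((R.slab 0).domain \ {x : Fin (j + 1) → ℝ | ∀ i, x i ∈ Set.Ioo (0:ℝ) 1}) = 0 := by
    refine measure_mono_null ?_
      (measure_union_null (volume_setOf_last_eq_zero (n := j) 0)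
        (volume_setOf_last_eq_zero (n := j) 1))
    rintro z ⟨⟨h1, h2, h3⟩, hz⟩
    rw [hRd] at h1
    simp only [Nat.cast_zero, zero_add] at h2 h3
    rw [mem_box_succ_iff, not_and] at hz
    have hz2 := hz h1
    rw [mem_Ioo, not_and, not_lt] at hz2
    rcases h2.eq_or_lt with h | h
    · exact Or.inl h.symm
    · exact Or.inr (le_antisymm h3 (hz2 h))
  have hinit : ∀ z : Fin (j + 1) → ℝ, z ∘ Fin.castSucc = Fin.init z := fun _ => rfl
  refine ⟨(R.slab 0).restrict _ (isSemialgebraic_box (j + 1)) hsub, rfl, ?_, ?_⟩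
  · obtain ⟨p, q, hq, hpq⟩ := hRr
    refine ⟨MvPolynomial.rename Fin.castSucc p, MvPolynomial.rename Fin.castSucc q, ?_, ?_⟩
    · intro z hz
      rw [MvPolynomial.aeval_rename, hinit]
      exact hq _ (by rw [hRd]; exact ((mem_box_succ_iff z).1 hz).1)
    · intro z hz
      show R.integrand (Fin.init z) = MvPolynomial.aeval z (MvPolynomial.rename Fin.castSucc p) /
        MvPolynomial.aeval z (MvPolynomial.rename Fin.castSucc q)
      rw [MvPolynomial.aeval_rename, MvPolynomial.aeval_rename, hinit]
      exact hpq (by rw [hRd]; exact ((mem_box_succ_iff z).1 hz).1)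
  · have h1 : of R - of (R.slab 0) ∈ relations := R.equivalent_slab 0
    have h2 := (R.slab 0).of_sub_of_restrict_mem_relations (isSemialgebraic_box (j + 1)) hsub hvol
    have := relations.add_mem h1 h2
    rwa [sub_add_sub_cancel] at this

/-- Padding by `d` unit intervals (iterate `pad_one`). [cite: KontsevichZagier2001, §1.2] -/
theorem pad_add (d : ℕ) : ∀ (j : ℕ) (R : IntegralRep j),
    R.domain = {x | ∀ i, x i ∈ Set.Ioo (0:ℝ) 1} → R.IsRational →
    ∃ R' : IntegralRep (j + d), R'.domain = {x | ∀ i, x i ∈ Set.Ioo (0:ℝ) 1} ∧ R'.IsRational ∧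
      of R - of R' ∈ relations := by
  induction d with
  | zero =>
    intro j R hRd hRr
    exact ⟨R, hRd, hRr, by simp [relations.zero_mem]⟩
  | succ d ih =>
    intro j R hRd hRr
    obtain ⟨R', hR'd, hR'r, h⟩ := ih j R hRd hRr
    obtain ⟨R'', hR''d, hR''r, h'⟩ := pad_one R' hR'd hR'r
    refine ⟨R'', hR''d, hR''r, ?_⟩
    have := relations.add_mem h h'
    rwa [sub_add_sub_cancel] at this

/-- Padding to any dimension `K ≥ j`. [cite: KontsevichZagier2001, §1.2] -/
theorem pad_le (h : j ≤ K) (R : IntegralRep j)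
    (hRd : R.domain = {x | ∀ i, x i ∈ Set.Ioo (0:ℝ) 1}) (hRr : R.IsRational) :
    ∃ R' : IntegralRep K, R'.domain = {x | ∀ i, x i ∈ Set.Ioo (0:ℝ) 1} ∧ R'.IsRational ∧
      of R - of R' ∈ relations := by
  obtain ⟨d, rfl⟩ := Nat.exists_eq_add_of_le h
  exact pad_add d j R hRd hRr

/-- **Subtracting on a common box** (rule 1b)): for box-rational `R₁`, `R₂` of the same dimension
with integrands `p₁/q₁`, `p₂/q₂` on the box, the representation `M = [(0,1)ᴷ, (p₁q₂ − q₁p₂)/(q₁q₂)]`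
is box-rational and `[R₁] − [R₂] − [M]` is an integrand-additivity move.
[cite: KontsevichZagier2001, §1.2] -/
theorem sub_same (R₁ R₂ : IntegralRep K)
    (h₁d : R₁.domain = {x | ∀ i, x i ∈ Set.Ioo (0:ℝ) 1}) (h₁r : R₁.IsRational)
    (h₂d : R₂.domain = {x | ∀ i, x i ∈ Set.Ioo (0:ℝ) 1}) (h₂r : R₂.IsRational) :
    ∃ M : IntegralRep K, M.domain = {x | ∀ i, x i ∈ Set.Ioo (0:ℝ) 1} ∧ M.IsRational ∧
      of R₁ - of R₂ - of M ∈ relations := by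
  obtain ⟨p₁, q₁, hq₁, hpq₁⟩ := h₁r
  obtain ⟨p₂, q₂, hq₂, hpq₂⟩ := h₂r
  rw [h₁d] at hq₁ hpq₁
  rw [h₂d] at hq₂ hpq₂
  have hσ : IsSemialgebraic ℚ {x : Fin K → ℝ | ∀ i, x i ∈ Set.Ioo (0:ℝ) 1} := isSemialgebraic_box K
  have hq : ∀ x ∈ {x : Fin K → ℝ | ∀ i, x i ∈ Set.Ioo (0:ℝ) 1},
      MvPolynomial.aeval x (q₁ * q₂) ≠ 0 := fun x hx => by
    rw [map_mul]
    exact mul_ne_zero (hq₁ x hx) (hq₂ x hx)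
  have heq : ∀ x ∈ {x : Fin K → ℝ | ∀ i, x i ∈ Set.Ioo (0:ℝ) 1},
      MvPolynomial.aeval x (p₁ * q₂ - q₁ * p₂) / MvPolynomial.aeval x (q₁ * q₂) =
        R₁.integrand x - R₂.integrand x := by
    intro x hx
    have e₁ : R₁.integrand x = MvPolynomial.aeval x p₁ / MvPolynomial.aeval x q₁ := hpq₁ hx
    have e₂ : R₂.integrand x = MvPolynomial.aeval x p₂ / MvPolynomial.aeval x q₂ := hpq₂ hx
    rw [e₁, e₂, div_sub_div _ _ (hq₁ x hx) (hq₂ x hx)]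
    simp only [map_sub, map_mul]
  have hi₁ : IntegrableOn R₁.integrand {x : Fin K → ℝ | ∀ i, x i ∈ Set.Ioo (0:ℝ) 1} :=
    h₁d ▸ R₁.integrableOn
  have hi₂ : IntegrableOn R₂.integrand {x : Fin K → ℝ | ∀ i, x i ∈ Set.Ioo (0:ℝ) 1} :=
    h₂d ▸ R₂.integrableOn
  let M : IntegralRep K :=
    { domain := {x | ∀ i, x i ∈ Set.Ioo (0:ℝ) 1}
      integrand := fun x =>
        MvPolynomial.aeval x (p₁ * q₂ - q₁ * p₂) / MvPolynomial.aeval x (q₁ * q₂)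
      isSemialgebraic_domain := hσ
      isSemialgebraicFunOn_integrand := isSemialgebraicFunOn_aeval_div_aeval hσ _ _ hq
      integrableOn :=
        (hi₁.sub hi₂).congr_fun (fun x hx => (heq x hx).symm)
          (Literature.ModelTheory.ExponentialFields.IsSemialgebraic.measurableSet_holds hσ) }
  refine ⟨M, rfl, ⟨p₁ * q₂ - q₁ * p₂, q₁ * q₂, hq, fun x _ => rfl⟩, ?_⟩
  refine integrandAddRel_subset_relations
    ⟨K, R₁, R₂, M, by rw [h₁d, h₂d], h₁d.symm, fun x hx => ?_, rfl⟩
  rw [h₁d] at hx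
  show R₁.integrand x = R₂.integrand x +
    MvPolynomial.aeval x (p₁ * q₂ - q₁ * p₂) / MvPolynomial.aeval x (q₁ * q₂)
  rw [heq x hx]
  ring

end stub_boxCombineAux

open stub_boxCombineAux in
/-- **The box-rational family is closed under differences**: for box-rational `N`, `N'` (any
dimensions `m`, `m'`) there is ONE box-rational `M` with `[N] − [N'] ≡ [M]`: pad both to dimension
`m + m'` by unit intervals (`KZ.IntegralRep.equivalent_slab`: `[N] ∼ [N × [0,1]]`, one Newton–Leibniz
move, rule 3); closed versus open last factor is a null set, rule 1a)), then subtract the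
integrands on the common box (rule 1b)); `p/q − p'/q' = (pq' − qp')/(qq')`.
[cite: KontsevichZagier2001, §1.2] -/
theorem stub_boxCombine :
    ∀ (m m' : ℕ) (N : IntegralRep m) (N' : IntegralRep m'),
      N.domain = {x | ∀ i, x i ∈ Set.Ioo (0:ℝ) 1} → N.IsRational →
      N'.domain = {x | ∀ i, x i ∈ Set.Ioo (0:ℝ) 1} → N'.IsRational →
      ∃ (k : ℕ) (M : IntegralRep k), M.domain = {x | ∀ i, x i ∈ Set.Ioo (0:ℝ) 1} ∧ M.IsRational ∧
        of N - of N' - of M ∈ relations := by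
  intro m m' N N' hNd hNr hN'd hN'r
  obtain ⟨R₁, h₁d, h₁r, h₁⟩ := pad_le (Nat.le_add_right m m') N hNd hNr
  obtain ⟨R₂, h₂d, h₂r, h₂⟩ := pad_le (Nat.le_add_left m' m) N' hN'd hN'r
  obtain ⟨M, hMd, hMr, hM⟩ := sub_same R₁ R₂ h₁d h₁r h₂d h₂r
  refine ⟨m + m', M, hMd, hMr, ?_⟩
  have : of N - of N' - of M = (of N - of R₁) - (of N' - of R₂) + (of R₁ - of R₂ - of M) := by
    abel
  rw [this]
  exact relations.add_mem (relations.sub_mem h₁ h₂) hM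

end Summit.KontsevichZagierPeriods.HurwitzMicroSectors.NormalFormPrinciple.PiBox
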